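import Summits.SmoothPoincare4.SmoothPoincare4.Theorems.CylinderEntropyCylinderRungTwoTiltExcess
import HarnessLib

/-!
# Route `CylinderEntropy`, crux `CylinderRungTwo` (stmt-SmoothPoincare4-7631), line `killing-flux`:
# the uniform local area bound from the two-scale Gaussian monotonicity inequality
# (registered helper `helper_localAreaBoundOfTwoScale`, static monotonicity step H6)

For a closed immersed cross-section `f : M⁴ → N = S⁴ × ℝ ⊂ ℝ⁶` with Riemannian measure `μ_g`
(`g = f^*δ`) and mean curvature `H`, write

  `F(s) = ∫_M e^{-‖f(w) - x₀‖² / 4s} (4πs)⁻² dμ_g(w)`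

for the Gaussian density ratio centred at `x₀ ∈ ℝ⁶` at scale `s > 0`. The TWO-SCALE MONOTONICITY
INEQUALITY (registered helper `helper_staticTwoScaleMonotonicity`, proved elsewhere and taken here
as a HYPOTHESIS) reads

  `e^{4σ} F(σ) ≤ e^{4τ} F(τ) + e^{4τ} (64π²σ)⁻¹ ∫_M H² dμ_g`,  `0 < σ ≤ τ`.

This file derives from it the UNIFORM LOCAL AREA BOUND every compactness theorem wants: for all
centres `x₀ ∈ ℝ⁶` and scales `0 < ρ ≤ R`,

  `μ_g(f⁻¹ B(x₀, ρ)) ≤ e^{4R² + 1/4} (μ_g(M) ρ⁴ / R⁴ + (ρ² / 4) ∫_M H² dμ_g)`.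

Proof (pure bookkeeping): apply the two-scale inequality with `σ = ρ²`, `τ = R²`;
(i) `F(ρ²) ≥ e^{-1/4} (4πρ²)⁻² μ_g(f⁻¹ B(x₀, ρ))` because the integrand is nonnegative and at least
`e^{-1/4} (4πρ²)⁻²` on `f⁻¹ B(x₀, ρ)` (`measureReal_preimage_ball_le_gaussianDensity`);
(ii) `F(R²) ≤ (4πR²)⁻² μ_g(M)` because `e^{-t} ≤ 1` (`gaussianDensity_le_measureReal_univ`);
(iii) `F(ρ²) ≤ e^{4ρ²} F(ρ²)`; (iv) algebra (`measureReal_preimage_ball_le_of_twoScale`).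
The registered helper `helper_localAreaBoundOfTwoScale` is the verbatim conditional statement.

Everything here is PROVED (no `sorry`, no definitions, no named facts).

References: T. H. Colding, W. P. Minicozzi II, Generic mean curvature flow I, Ann. of Math. 175
(2012), §3 (Gaussian densities); L. Simon, *Lectures on Geometric Measure Theory* (1983), §17
(monotonicity formula and density / local area bounds).
-/

-- the prescribed namespace `Summit.SmoothPoincare4.SmoothPoincare4.…` repeats `SmoothPoincare4`
set_option linter.dupNamespace false

noncomputable section

open Bundle Set Function Filter MeasureTheory Module
open scoped Manifold ContDiff Topology RealInnerProductSpace BigOperators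

namespace Summit.SmoothPoincare4.SmoothPoincare4.Cruxes.CylinderRungTwo.KillingFlux

open Literature.Geometry.Riemannian Literature.Geometry.Riemannian.EuclideanHypersurface
open Literature.Geometry.Lorentzian Literature.Geometry.Lorentzian.PseudoRiemannianMetric

section GaussianDensityBounds

/-- The Gaussian weight `e^{-‖f(w) - x₀‖² / 4s} (4πs)⁻²` pulled back along any map `f : M → ℝ⁶` is
nonnegative. [folklore] -/
theorem gaussianWeight_comp_nonneg {M : Type*} (f : M → EuclideanSpace ℝ (Fin 6))
    (x₀ : EuclideanSpace ℝ (Fin 6)) {s : ℝ} (w : M) :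
    0 ≤ Real.exp (-‖f w - x₀‖ ^ 2 / (4 * s)) / (4 * Real.pi * s) ^ 2 := by
  positivity

variable {M : Type*} [TopologicalSpace M] [ChartedSpace (EuclideanSpace ℝ (Fin 4)) M]
  [IsManifold (𝓡 4) ∞ M] [CompactSpace M] [T2Space M] [MeasurableSpace M] [BorelSpace M]

omit [IsManifold (𝓡 4) ∞ M] [CompactSpace M] [T2Space M] [MeasurableSpace M] [BorelSpace M] in
/-- The Gaussian weight `w ↦ e^{-‖f(w) - x₀‖² / 4s} (4πs)⁻²` pulled back along a smooth immersion
`f : M → ℝ⁶` is continuous. [folklore] -/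
theorem continuous_gaussianWeight_comp {f : M → EuclideanSpace ℝ (Fin 6)}
    (hf : (euclideanMetric (EuclideanSpace ℝ (Fin 6))).IsSpacelikeImmersion (𝓡 4) f)
    (x₀ : EuclideanSpace ℝ (Fin 6)) (s : ℝ) :
    Continuous fun w => Real.exp (-‖f w - x₀‖ ^ 2 / (4 * s)) / (4 * Real.pi * s) ^ 2 := by
  have hfc : Continuous f := hf.contMDiff_self.continuous
  fun_prop

/-- **Lower bound of the Gaussian density by local area**: for a closed immersed `f : M⁴ → ℝ⁶`,
`x₀ ∈ ℝ⁶` and `ρ > 0`,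
`e^{-1/4} (4πρ²)⁻² μ_g(f⁻¹ B(x₀, ρ)) ≤ F(ρ²) = ∫_M e^{-‖f - x₀‖² / 4ρ²} (4πρ²)⁻² dμ_g`:
the integrand is nonnegative and on `f⁻¹ B(x₀, ρ)` (where `‖f - x₀‖² < ρ²`) it is at least
`e^{-1/4} (4πρ²)⁻²`; integrate the indicator (`integral_indicator_const`, `integral_mono`; the
weight is continuous on the compact `M`, hence integrable for the finite measure `μ_g`).
[cite: Simon1983, §17] -/
theorem measureReal_preimage_ball_le_gaussianDensity {f : M → EuclideanSpace ℝ (Fin 6)}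
    (hf : (euclideanMetric (EuclideanSpace ℝ (Fin 6))).IsSpacelikeImmersion (𝓡 4) f)
    (x₀ : EuclideanSpace ℝ (Fin 6)) {ρ : ℝ} (hρ : 0 < ρ) :
    (riemannianMeasure ((euclideanMetric (EuclideanSpace ℝ (Fin 6))).inducedRiemannianMetric f
        contMDiff_pullbackBilin_holds hf)).real (f ⁻¹' Metric.ball x₀ ρ) *
        (Real.exp (-(1 / 4)) / (4 * Real.pi * ρ ^ 2) ^ 2) ≤
      ∫ w, Real.exp (-‖f w - x₀‖ ^ 2 / (4 * ρ ^ 2)) / (4 * Real.pi * ρ ^ 2) ^ 2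
        ∂riemannianMeasure ((euclideanMetric (EuclideanSpace ℝ (Fin 6))).inducedRiemannianMetric f
          contMDiff_pullbackBilin_holds hf) := by
  set g₁ := (euclideanMetric (EuclideanSpace ℝ (Fin 6))).inducedRiemannianMetric f
    contMDiff_pullbackBilin_holds hf with hg₁
  haveI : IsFiniteMeasure (riemannianMeasure g₁) := isFiniteMeasure_riemannianMeasure g₁
  have hfc : Continuous f := hf.contMDiff_self.continuous
  have hS : MeasurableSet (f ⁻¹' Metric.ball x₀ ρ) :=
    (Metric.isOpen_ball.preimage hfc).measurableSet
  have key : ∫ w, (f ⁻¹' Metric.ball x₀ ρ).indicator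
        (fun _ => Real.exp (-(1 / 4)) / (4 * Real.pi * ρ ^ 2) ^ 2) w ∂riemannianMeasure g₁ ≤
      ∫ w, Real.exp (-‖f w - x₀‖ ^ 2 / (4 * ρ ^ 2)) / (4 * Real.pi * ρ ^ 2) ^ 2
        ∂riemannianMeasure g₁ := by
    refine integral_mono ((integrable_const _).indicator hS)
      (integrable_of_continuous (h := g₁) (continuous_gaussianWeight_comp hf x₀ (ρ ^ 2)))
      fun w => ?_
    by_cases hw : w ∈ f ⁻¹' Metric.ball x₀ ρ
    · rw [indicator_of_mem hw]
      have hlt : ‖f w - x₀‖ < ρ := by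
        simpa only [mem_preimage, Metric.mem_ball, dist_eq_norm] using hw
      have hsq : ‖f w - x₀‖ ^ 2 ≤ ρ ^ 2 := pow_le_pow_left₀ (norm_nonneg _) hlt.le 2
      have hρ2 : 0 < 4 * ρ ^ 2 := by positivity
      refine div_le_div_of_nonneg_right (Real.exp_le_exp.2 ?_) (by positivity)
      rw [le_div_iff₀ hρ2]
      linarith
    · rw [indicator_of_notMem hw]
      exact gaussianWeight_comp_nonneg f x₀ w
  rwa [integral_indicator_const _ hS, smul_eq_mul] at key

/-- **Upper bound of the Gaussian density by total area**: for a closed immersed `f : M⁴ → ℝ⁶`,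
`x₀ ∈ ℝ⁶` and `R ∈ ℝ`, `F(R²) = ∫_M e^{-‖f - x₀‖² / 4R²} (4πR²)⁻² dμ_g ≤ (4πR²)⁻² μ_g(M)`
(`e^{-t} ≤ 1` for `t ≥ 0`; `integral_mono` against the constant and `integral_const`).
[cite: Simon1983, §17] -/
theorem gaussianDensity_le_measureReal_univ {f : M → EuclideanSpace ℝ (Fin 6)}
    (hf : (euclideanMetric (EuclideanSpace ℝ (Fin 6))).IsSpacelikeImmersion (𝓡 4) f)
    (x₀ : EuclideanSpace ℝ (Fin 6)) (R : ℝ) :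
    ∫ w, Real.exp (-‖f w - x₀‖ ^ 2 / (4 * R ^ 2)) / (4 * Real.pi * R ^ 2) ^ 2
        ∂riemannianMeasure ((euclideanMetric (EuclideanSpace ℝ (Fin 6))).inducedRiemannianMetric f
          contMDiff_pullbackBilin_holds hf) ≤
      (riemannianMeasure ((euclideanMetric (EuclideanSpace ℝ (Fin 6))).inducedRiemannianMetric f
        contMDiff_pullbackBilin_holds hf)).real Set.univ * (1 / (4 * Real.pi * R ^ 2) ^ 2) := by
  set g₁ := (euclideanMetric (EuclideanSpace ℝ (Fin 6))).inducedRiemannianMetric f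
    contMDiff_pullbackBilin_holds hf with hg₁
  haveI : IsFiniteMeasure (riemannianMeasure g₁) := isFiniteMeasure_riemannianMeasure g₁
  have key : ∫ w, Real.exp (-‖f w - x₀‖ ^ 2 / (4 * R ^ 2)) / (4 * Real.pi * R ^ 2) ^ 2
        ∂riemannianMeasure g₁ ≤
      ∫ _, 1 / (4 * Real.pi * R ^ 2) ^ 2 ∂riemannianMeasure g₁ := by
    refine integral_mono
      (integrable_of_continuous (h := g₁) (continuous_gaussianWeight_comp hf x₀ (R ^ 2)))
      (integrable_const _) fun w => ?_
    refine div_le_div_of_nonneg_right (Real.exp_le_one_iff.2 ?_) (by positivity)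
    exact div_nonpos_of_nonpos_of_nonneg (neg_nonpos.2 (sq_nonneg _)) (by positivity)
  rwa [integral_const, smul_eq_mul] at key

/-- **Local area bound from the two-scale inequality** (implicit binders). If the Gaussian
density ratios `F(s) = ∫_M e^{-‖f - x₀‖² / 4s} (4πs)⁻² dμ_g` of a closed immersed `f : M⁴ → ℝ⁶`
centred at `x₀` satisfy the two-scale monotonicity inequality
`e^{4σ} F(σ) ≤ e^{4τ} F(τ) + e^{4τ} (64π²σ)⁻¹ ∫_M H² dμ_g` for `0 < σ ≤ τ`, then for `0 < ρ ≤ R`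
`μ_g(f⁻¹ B(x₀, ρ)) ≤ e^{4R² + 1/4} (μ_g(M) ρ⁴ / R⁴ + (ρ² / 4) ∫_M H² dμ_g)`:
take `σ = ρ²`, `τ = R²`, bound `F(ρ²)` below by `measureReal_preimage_ball_le_gaussianDensity`,
`F(R²)` above by `gaussianDensity_le_measureReal_univ`, drop `e^{4ρ²} ≥ 1`, and simplify.
[cite: Simon1983, §17] -/
theorem measureReal_preimage_ball_le_of_twoScale {f νf : M → EuclideanSpace ℝ (Fin 6)}
    (hf : (euclideanMetric (EuclideanSpace ℝ (Fin 6))).IsSpacelikeImmersion (𝓡 4) f)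
    {x₀ : EuclideanSpace ℝ (Fin 6)}
    (hTS : ∀ σ τ : ℝ, 0 < σ → σ ≤ τ →
      Real.exp (4 * σ) * ∫ w, Real.exp (-‖f w - x₀‖ ^ 2 / (4 * σ)) / (4 * Real.pi * σ) ^ 2
          ∂riemannianMeasure ((euclideanMetric (EuclideanSpace ℝ (Fin 6))).inducedRiemannianMetric f
            contMDiff_pullbackBilin_holds hf) ≤
        Real.exp (4 * τ) * ∫ w, Real.exp (-‖f w - x₀‖ ^ 2 / (4 * τ)) / (4 * Real.pi * τ) ^ 2
            ∂riemannianMeasure ((euclideanMetric (EuclideanSpace ℝ (Fin 6))).inducedRiemannianMetric f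
              contMDiff_pullbackBilin_holds hf) +
          Real.exp (4 * τ) / (64 * Real.pi ^ 2 * σ) *
            ∫ w, (euclideanMetric (EuclideanSpace ℝ (Fin 6))).meanCurvature f
                contMDiff_pullbackBilin_holds hf νf w ^ 2
              ∂riemannianMeasure ((euclideanMetric (EuclideanSpace ℝ (Fin 6))).inducedRiemannianMetric f
                contMDiff_pullbackBilin_holds hf))
    {ρ R : ℝ} (hρ : 0 < ρ) (hρR : ρ ≤ R) :
    (riemannianMeasure ((euclideanMetric (EuclideanSpace ℝ (Fin 6))).inducedRiemannianMetric f
        contMDiff_pullbackBilin_holds hf)).real (f ⁻¹' Metric.ball x₀ ρ) ≤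
      Real.exp (4 * R ^ 2 + 1 / 4) *
        ((riemannianMeasure ((euclideanMetric (EuclideanSpace ℝ (Fin 6))).inducedRiemannianMetric f
            contMDiff_pullbackBilin_holds hf)).real Set.univ * (ρ ^ 4 / R ^ 4) +
          ρ ^ 2 / 4 * ∫ w, (euclideanMetric (EuclideanSpace ℝ (Fin 6))).meanCurvature f
              contMDiff_pullbackBilin_holds hf νf w ^ 2
            ∂riemannianMeasure ((euclideanMetric (EuclideanSpace ℝ (Fin 6))).inducedRiemannianMetric f
              contMDiff_pullbackBilin_holds hf)) := by
  set g₁ := (euclideanMetric (EuclideanSpace ℝ (Fin 6))).inducedRiemannianMetric f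
    contMDiff_pullbackBilin_holds hf with hg₁
  set J : ℝ := ∫ w, (euclideanMetric (EuclideanSpace ℝ (Fin 6))).meanCurvature f
    contMDiff_pullbackBilin_holds hf νf w ^ 2 ∂riemannianMeasure g₁ with hJ
  set A : ℝ := ∫ w, Real.exp (-‖f w - x₀‖ ^ 2 / (4 * ρ ^ 2)) / (4 * Real.pi * ρ ^ 2) ^ 2
    ∂riemannianMeasure g₁ with hA
  set B : ℝ := ∫ w, Real.exp (-‖f w - x₀‖ ^ 2 / (4 * R ^ 2)) / (4 * Real.pi * R ^ 2) ^ 2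
    ∂riemannianMeasure g₁ with hB
  set m : ℝ := (riemannianMeasure g₁).real (f ⁻¹' Metric.ball x₀ ρ) with hm
  set U : ℝ := (riemannianMeasure g₁).real Set.univ with hU
  have hR : 0 < R := hρ.trans_le hρR
  have hπ : 0 < Real.pi := Real.pi_pos
  -- the two-scale inequality at `σ = ρ²`, `τ = R²`
  have h3 : Real.exp (4 * ρ ^ 2) * A ≤
      Real.exp (4 * R ^ 2) * B + Real.exp (4 * R ^ 2) / (64 * Real.pi ^ 2 * ρ ^ 2) * J :=
    hTS (ρ ^ 2) (R ^ 2) (by positivity) (pow_le_pow_left₀ hρ.le hρR 2)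
  -- (i) lower bound of `F(ρ²)` by the local area, (ii) upper bound of `F(R²)` by the total area
  have h1 : m * (Real.exp (-(1 / 4)) / (4 * Real.pi * ρ ^ 2) ^ 2) ≤ A :=
    measureReal_preimage_ball_le_gaussianDensity hf x₀ hρ
  have h2 : B ≤ U * (1 / (4 * Real.pi * R ^ 2) ^ 2) := gaussianDensity_le_measureReal_univ hf x₀ R
  -- (iii) `F(ρ²) ≥ 0`, `e^{4ρ²} ≥ 1`
  have hA0 : 0 ≤ A := integral_nonneg fun w => gaussianWeight_comp_nonneg f x₀ w
  have he : 1 ≤ Real.exp (4 * ρ ^ 2) := Real.one_le_exp (by positivity)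
  have hE : 0 ≤ Real.exp (4 * R ^ 2) := (Real.exp_pos _).le
  have hP : 0 < (4 * Real.pi * ρ ^ 2) ^ 2 := by positivity
  -- (iv) algebra
  calc m = m * (Real.exp (-(1 / 4)) / (4 * Real.pi * ρ ^ 2) ^ 2) *
        (Real.exp (1 / 4) * (4 * Real.pi * ρ ^ 2) ^ 2) := by
        rw [Real.exp_neg]
        field_simp
    _ ≤ A * (Real.exp (1 / 4) * (4 * Real.pi * ρ ^ 2) ^ 2) := by gcongr
    _ ≤ Real.exp (4 * ρ ^ 2) * A * (Real.exp (1 / 4) * (4 * Real.pi * ρ ^ 2) ^ 2) := by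
        gcongr
        exact le_mul_of_one_le_left hA0 he
    _ ≤ (Real.exp (4 * R ^ 2) * B + Real.exp (4 * R ^ 2) / (64 * Real.pi ^ 2 * ρ ^ 2) * J) *
          (Real.exp (1 / 4) * (4 * Real.pi * ρ ^ 2) ^ 2) := by gcongr
    _ ≤ (Real.exp (4 * R ^ 2) * (U * (1 / (4 * Real.pi * R ^ 2) ^ 2)) +
            Real.exp (4 * R ^ 2) / (64 * Real.pi ^ 2 * ρ ^ 2) * J) *
          (Real.exp (1 / 4) * (4 * Real.pi * ρ ^ 2) ^ 2) := by gcongr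
    _ = Real.exp (4 * R ^ 2 + 1 / 4) * (U * (ρ ^ 4 / R ^ 4) + ρ ^ 2 / 4 * J) := by
        rw [Real.exp_add]
        field_simp
        ring

end GaussianDensityBounds

/-- **Registered helper `helper_localAreaBoundOfTwoScale` of line `killing-flux` (static Gaussian
monotonicity, step H6: the uniform local area bound).** IF the two-scale monotonicity inequality
`e^{4σ} F(σ) ≤ e^{4τ} F(τ) + e^{4τ} (64π²σ)⁻¹ ∫_M H² dμ_g` (`0 < σ ≤ τ`) holds for the Gaussian
density ratios `F(s) = ∫_M e^{-‖f - x₀‖² / 4s} (4πs)⁻² dμ_g` of every closed immersed cross-section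
`f : M⁴ → N = S⁴ × ℝ ⊂ ℝ⁶` with smooth unit normal `ν` tangent to `N` (registered helper
`helper_staticTwoScaleMonotonicity`), THEN every such cross-section obeys the uniform local area
bound `μ_g(f⁻¹ B(x₀, ρ)) ≤ e^{4R² + 1/4} (μ_g(M) ρ⁴ / R⁴ + (ρ² / 4) ∫_M H² dμ_g)` for all
`x₀ ∈ ℝ⁶`, `0 < ρ ≤ R` (`measureReal_preimage_ball_le_of_twoScale`). [cite: Simon1983, §17] -/
theorem helper_localAreaBoundOfTwoScale : (∀ (M : Type) [TopologicalSpace M] [ChartedSpace (EuclideanSpace ℝ (Fin 4)) M] [IsManifold (𝓡 4) ∞ M] [CompactSpace M] [T2Space M] [MeasurableSpace M] [BorelSpace M] (f νf : M → EuclideanSpace ℝ (Fin 6)) (hf : (Literature.Geometry.Riemannian.euclideanMetric (EuclideanSpace ℝ (Fin 6))).IsSpacelikeImmersion (𝓡 4) f), ContMDiff (𝓡 4) (𝓡 6) ∞ νf → (Literature.Geometry.Riemannian.euclideanMetric (EuclideanSpace ℝ (Fin 6))).IsUnitNormal (𝓡 4) f νf 1 → (∀ x, ∑ i : Fin 5,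 f x (Fin.castSucc i) ^ 2 = 1) → (∀ x, ∑ i : Fin 5, νf x (Fin.castSucc i) * f x (Fin.castSucc i) = 0) → ∀ (x₀ : EuclideanSpace ℝ (Fin 6)) (σ τ : ℝ), 0 < σ → σ ≤ τ → Real.exp (4 * σ) * ∫ w, Real.exp (-‖f w - x₀‖ ^ 2 / (4 * σ)) / (4 * Real.pi * σ) ^ 2 ∂Literature.Geometry.Lorentzian.riemannianMeasure ((Literature.Geometry.Riemannian.euclideanMetric (EuclideanSpace ℝ (Fin 6))).inducedRiemannianMetric f Literature.Geometry.Lorentzian.PseudoRiemannianMetric.contMDiff_pullbackBilin_holds hf) ≤ Real.exp (4 * τ) * ∫ w, Real.exp (-‖f w - x₀‖ ^ 2 / (4 * τ)) / (4 * Real.pi * τ) ^ 2 ∂Literature.Geometry.Lorentzian.riemannianMeasure ((Literature.Geometry.Riemannian.euclideanMetric (EuclideanSpace ℝ (Fin 6))).inducedRiemannianMetric f Literature.Geometry.Lorentzian.PseudoRiemannianMetric.contMDiff_pullbackBilin_holds hf) + Real.exp (4 * τ) / (64 * Real.pi ^ 2 * σ) * ∫ w, (Literature.Geometry.Riemannian.euclideanMetric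 (EuclideanSpace ℝ (Fin 6))).meanCurvature f Literature.Geometry.Lorentzian.PseudoRiemannianMetric.contMDiff_pullbackBilin_holds hf νf w ^ 2 ∂Literature.Geometry.Lorentzian.riemannianMeasure ((Literature.Geometry.Riemannian.euclideanMetric (EuclideanSpace ℝ (Fin 6))).inducedRiemannianMetric f Literature.Geometry.Lorentzian.PseudoRiemannianMetric.contMDiff_pullbackBilin_holds hf)) → ∀ (M : Type) [TopologicalSpace M] [ChartedSpace (EuclideanSpace ℝ (Fin 4)) M] [IsManifold (𝓡 4) ∞ M] [CompactSpace M] [T2Space M] [MeasurableSpace M] [BorelSpace M] (f νf : M → EuclideanSpace ℝ (Fin 6)) (hf : (Literature.Geometry.Riemannian.euclideanMetric (EuclideanSpace ℝ (Fin 6))).IsSpacelikeImmersion (𝓡 4) f), ContMDiff (𝓡 4) (𝓡 6) ∞ νf → (Literature.Geometry.Riemannian.euclideanMetric (EuclideanSpace ℝ (Fin 6))).IsUnitNormal (𝓡 4) f νf 1 → (∀ x, ∑ i : Fin 5, f x (Fin.castSucc i) ^ 2 = 1) → (∀ x, ∑ i : Fin 5, νf x (Fin.castSucc i) * f x (Fin.castSucc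 i) = 0) → ∀ (x₀ : EuclideanSpace ℝ (Fin 6)) (ρ R : ℝ), 0 < ρ → ρ ≤ R → (Literature.Geometry.Lorentzian.riemannianMeasure ((Literature.Geometry.Riemannian.euclideanMetric (EuclideanSpace ℝ (Fin 6))).inducedRiemannianMetric f Literature.Geometry.Lorentzian.PseudoRiemannianMetric.contMDiff_pullbackBilin_holds hf)).real (f ⁻¹' Metric.ball x₀ ρ) ≤ Real.exp (4 * R ^ 2 + 1 / 4) * ((Literature.Geometry.Lorentzian.riemannianMeasure ((Literature.Geometry.Riemannian.euclideanMetric (EuclideanSpace ℝ (Fin 6))).inducedRiemannianMetric f Literature.Geometry.Lorentzian.PseudoRiemannianMetric.contMDiff_pullbackBilin_holds hf)).real Set.univ * (ρ ^ 4 / R ^ 4) + ρ ^ 2 / 4 * ∫ w, (Literature.Geometry.Riemannian.euclideanMetric (EuclideanSpace ℝ (Fin 6))).meanCurvature f Literature.Geometry.Lorentzian.PseudoRiemannianMetric.contMDiff_pullbackBilin_holds hf νf w ^ 2 ∂Literature.Geometry.Lorentzian.riemannianMeasure ((Literature.Geometry.Riemannian.euclideanMetric (EuclideanSpace ℝ (Fin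 6))).inducedRiemannianMetric f Literature.Geometry.Lorentzian.PseudoRiemannianMetric.contMDiff_pullbackBilin_holds hf)) := by
  intro hTS M _ _ _ _ _ _ _ f νf hf hν hun hN hνN x₀ ρ R hρ hρR
  exact measureReal_preimage_ball_le_of_twoScale hf (hTS M f νf hf hν hun hN hνN x₀) hρ hρR

end Summit.SmoothPoincare4.SmoothPoincare4.Cruxes.CylinderRungTwo.KillingFlux

end
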